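import Summits.BirchSwinnertonDyer.BirchSwinnertonDyer.Theorems.AdditiveBranchIMCGordTwoRankZeroOffCaseOneTwistOddRowClosedKolyvagin
import Summits.BirchSwinnertonDyer.BirchSwinnertonDyer.Theorems.AdditiveBranchIMCGordTwoRankZeroOffCaseOneThreeFieldRowBSDp
import HarnessLib

/-!
# Line `three_field_road` (crux `GordTwoRankZeroOffCaseOne`, stmt-BirchSwinnertonDyer-19357) — THE BOOKING DOOR ON THE ODD-TWIST-TYPE SUB-ROW:
# `BSD(E,p)` from the same fourteen printed names, for curves with additive primes `ℓ ≠ p` odd and of quadratic-twist type (LEAD g13)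

Sequel of `AdditiveBranchIMCGordTwoRankZeroOffCaseOneThreeFieldRowBSDp.lean` (p749350, LEAD g12: the door on the three-field sub-row, «`E`
semistable outside `p`»). The line's lower half now holds on the larger ODD-TWIST-TYPE sub-row (skeleton v34;
`TwistOddRowClosedKolyvagin.missingLowerBoundAt_rankZero_of_twistOdd_twelveFacts_kolyvagin`: `p ≥ 5`, `ρ̄` onto, no additive reduction above
`2`, every odd additive prime of quadratic-twist type, a Wan prime, `p ∤ ∏ c_ℓ`), and the upper-half glue
`ThreeFieldRowBSDp.bsdp_rankZero_of_cellGordTwo_of_surj_of_lower` (Kato 17.4 (3) component reading + Delbourgo Prop. 4, b2b kernel) never read the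
semistability clause. Hence the door widens with the line:

* `bsdp_rankZero_of_twistOddRow_fourteenFacts` — `BSD(E,p)` on the odd-twist-type sub-row from the fourteen names (Kato component reading,
  Delbourgo Prop. 4, and the line's twelve with the Castella–Liu–Wan pair in the semistable-twist reading);
* `bsdp_rankZero_of_twistOddRow_fourteenFacts_katoHalf` — the same keyed on the cell's Kato–Wuthrich half-eigen name.

Decidable binders for the booking desk: `r_an = 0`; `CellGordTwo`; `5 ≤ p`; `Surj`; «`E` has no additive prime `2`» and «at every odd
additive prime `ℓ` (incl. `p`), `E^{(ℓ*)}` is not additive at `ℓ`» (Kodaira `I₀*`/`Iₙ*` at `ℓ ≥ 5`; at `3`: `v₃(N) = 2` with `E^{(−3)}`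
semistable); a Wan prime `q` (`q ≠ p, 2`, non-split multiplicative, `p ∤ v_q(Δ_min)`); `p ∤ ∏ c_ℓ`. THEOREMS ONLY; nothing is booked by this
file; the crux stays OPEN; BSD is proved for no curve beyond print by any of this.
References: [Kato2004Asterisque] Thm. 17.4 (3) p. 273; [Delbourgo1998] Prop. 4 p. 144; [Kolyvagin1990] Thm. A; [SkinnerUrban2014] Thm. 2 (a);
[CastellaLiuWan2022] Thm. 8.2.1; [Wuthrich2014] Thm. 3.
-/

set_option linter.dupNamespace false
set_option autoImplicit false

noncomputable section

open scoped Classical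

open NumberField IsDedekindDomain Rat.HeightOneSpectrum
open WeierstrassCurve Literature.NumberTheory.EllipticCurves
  Literature.NumberTheory.EllipticCurves.ModularForms
  Literature.NumberTheory.EllipticCurves.Rank1Residual
  Literature.NumberTheory.EllipticCurves.Rank1Residual.Typed

open Summit.BirchSwinnertonDyer.Rank1Residual
open Summit.BirchSwinnertonDyer.Rank1Residual.Additive
open Summit.BirchSwinnertonDyer.BirchSwinnertonDyer.Theorems
open ThreeFieldRoadSupply
open Summit.BirchSwinnertonDyer.BirchSwinnertonDyer.Theses.AdditiveBranchIMC

namespace Summit.BirchSwinnertonDyer.BirchSwinnertonDyer.Theorems.TwistOddRowBSDp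

/-- **`BSD(E,p)` ON THE ODD-TWIST-TYPE SUB-ROW FROM FOURTEEN PRINTED THEOREMS BY NAME.** For every globally minimal elliptic `E/ℚ` of analytic
rank `0` and every prime `p` with `(E, p)` on cell (G-ord, `e = 2`), `p ≥ 5`, `ρ̄_{E,p}` onto, NO additive reduction above `2`, every ODD
additive prime of quadratic-twist type, a Wan prime `q` and `p ∤ ∏ c_ℓ(E)`: `BSDp W p`, GIVEN Kato 2004 Thm. 17.4 (3) (component reading),
Delbourgo 1998 Prop. 4, Bump–Friedberg–Hoffstein 1990 (i), Kolyvagin 1990 Thm. A, a modular parametrisation, Skinner–Urban 2014 Thm. 2 (a),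
Cai–Shu–Tian 2014 Thm. 1.1 (ring class), Mazur 1978 Cor. 4.1, Hsieh 2014 Thm. B, Liu–Zhang–Zhang 2018, Hoffstein–Luo 1997, the Eichler–Shimura
relation, Castella–Liu–Wan 2022 Thm. 8.2.1 and §6.1 (semistable-twist reading). Upper half: `ThreeFieldRowBSDp.bsdp_rankZero_of_cellGordTwo_of_surj_of_lower`;
lower half: `TwistOddRowClosedKolyvagin.missingLowerBoundAt_rankZero_of_twistOdd_twelveFacts_kolyvagin`.
[cite: Kato2004Asterisque, Thm. 17.4 (3) (p. 273)] [cite: Delbourgo1998, Prop. 4 (p. 144)] [cite: Kolyvagin1990, Thm. A]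
[cite: SkinnerUrban2014, Thm. 2 (a)] [cite: CastellaLiuWan2022, Thm. 8.2.1 (p. 85) (Forum Math. Sigma 10 (2022) e110)] -/
theorem bsdp_rankZero_of_twistOddRow_fourteenFacts
    (hK : Kato2004.charIdeal_dvd_padicLFunctionBranch_component_of_surjective)
    (hDel : Delbourgo1998.prop4_rankZero_pow_dvd_constantCoeff)
    (hBFH : bumpFriedbergHoffstein_exists_heegnerField_split_twist_simpleZero)
    (hKo : ∀ (N : ℕ) [NeZero N] (W : WeierstrassCurve ℚ) (K : Type) [Field K] [NumberField K], kolyvagin N W K)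
    (hmodP : nonempty_modularParametrizationData) (hSU : padicValRat_bsd_rank_zero)
    (hCSTrc : CaiShuTian2014.thm11_ringClassChar) (hMaz : mazur_not_dvd_maninConstant_of_odd)
    (hB : Hsieh2014.thmB_exists_isHsiehLFunction_coeff_norm_eq_one_unrPeriod_ramifiedSteinberg)
    (hLZZ : LiuZhangZhang2018.thm151_thm153_modularCurve_heegnerVector_additive_ramifiedSteinberg)
    (hHL : HoffsteinLuo1997_exists_twist_L_one_ne_zero)
    (hES : ModularForms.eichlerShimuraRelation_heckeNeighbour)
    (h821 : CastellaLiuWan2022.thm821_XGr₂_charIdeal_mul_le_awayFromCyc_semistableTwist)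
    (h61 : CastellaLiuWan2022.sec61_exists_isCastellaLiuWanLFunction₂_semistableTwist)
    (W : WeierstrassCurve ℚ) [W.IsElliptic] [W.IsGloballyMinimal] (p : ℕ) [Fact p.Prime]
    (hr : W.analyticRank = 0) (hcell : N10.CellGordTwo W p) (hp5 : 5 ≤ p) (hsurj : Surj W p)
    (h2 : ∀ v : HeightOneSpectrum ℤ, W.HasAdditiveReductionAt v → 2 < ringChar (ℤ ⧸ v.asIdeal))
    (htt : ∀ r : Nat.Primes, (r : ℕ) ≠ 2 → W.HasAdditiveReductionAt ((primesEquiv (R := ℤ)).symm r) →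
      ¬ (W.quadraticTwist (((-1 : ℤ) ^ ((r : ℕ) / 2) * r : ℤ) : ℚ)).HasAdditiveReductionAt
        ((primesEquiv (R := ℤ)).symm r))
    {q : ℕ} [Fact q.Prime] (hWan : WanPrime W p q) (htam : ¬ p ∣ W.tamagawaProduct) : BSDp W p :=
  ThreeFieldRowBSDp.bsdp_rankZero_of_cellGordTwo_of_surj_of_lower hK hDel
    (ExplicitGrossZagierTrivialChar.rank_eq_analyticRank_of_analyticRank_le_one_of_kolyvagin hmodP hHL hBFH hCSTrc hKo) hmodP W p
    hp5 hr hcell hsurj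
    (TwistOddRowClosedKolyvagin.missingLowerBoundAt_rankZero_of_twistOdd_twelveFacts_kolyvagin hBFH hKo hmodP hSU hCSTrc hMaz hB hLZZ
      hHL hES h821 h61 W p hr hcell hp5 hsurj h2 htt hWan htam)

/-- **The same door keyed on the cell's Kato–Wuthrich half-eigen name** (`Wuthrich2014.kato_halfEigenCharIdeal_dvd_cyclotomicPrime_of_surjective`;
the component reading follows in the tree, `Kato2004.charIdeal_dvd_padicLFunctionBranch_component_of_surjective_of_half`).
[cite: Kato2004Asterisque, Thm. 17.4 (3) (p. 273)] [cite: Wuthrich2014, Thm. 3 and §3 (pp. 383–390)] [cite: Delbourgo1998, Prop. 4 (p. 144)] -/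
theorem bsdp_rankZero_of_twistOddRow_fourteenFacts_katoHalf
    (hWu : Wuthrich2014.kato_halfEigenCharIdeal_dvd_cyclotomicPrime_of_surjective)
    (hDel : Delbourgo1998.prop4_rankZero_pow_dvd_constantCoeff)
    (hBFH : bumpFriedbergHoffstein_exists_heegnerField_split_twist_simpleZero)
    (hKo : ∀ (N : ℕ) [NeZero N] (W : WeierstrassCurve ℚ) (K : Type) [Field K] [NumberField K], kolyvagin N W K)
    (hmodP : nonempty_modularParametrizationData) (hSU : padicValRat_bsd_rank_zero)
    (hCSTrc : CaiShuTian2014.thm11_ringClassChar) (hMaz : mazur_not_dvd_maninConstant_of_odd)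
    (hB : Hsieh2014.thmB_exists_isHsiehLFunction_coeff_norm_eq_one_unrPeriod_ramifiedSteinberg)
    (hLZZ : LiuZhangZhang2018.thm151_thm153_modularCurve_heegnerVector_additive_ramifiedSteinberg)
    (hHL : HoffsteinLuo1997_exists_twist_L_one_ne_zero)
    (hES : ModularForms.eichlerShimuraRelation_heckeNeighbour)
    (h821 : CastellaLiuWan2022.thm821_XGr₂_charIdeal_mul_le_awayFromCyc_semistableTwist)
    (h61 : CastellaLiuWan2022.sec61_exists_isCastellaLiuWanLFunction₂_semistableTwist)
    (W : WeierstrassCurve ℚ) [W.IsElliptic] [W.IsGloballyMinimal] (p : ℕ) [Fact p.Prime]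
    (hr : W.analyticRank = 0) (hcell : N10.CellGordTwo W p) (hp5 : 5 ≤ p) (hsurj : Surj W p)
    (h2 : ∀ v : HeightOneSpectrum ℤ, W.HasAdditiveReductionAt v → 2 < ringChar (ℤ ⧸ v.asIdeal))
    (htt : ∀ r : Nat.Primes, (r : ℕ) ≠ 2 → W.HasAdditiveReductionAt ((primesEquiv (R := ℤ)).symm r) →
      ¬ (W.quadraticTwist (((-1 : ℤ) ^ ((r : ℕ) / 2) * r : ℤ) : ℚ)).HasAdditiveReductionAt
        ((primesEquiv (R := ℤ)).symm r))
    {q : ℕ} [Fact q.Prime] (hWan : WanPrime W p q) (htam : ¬ p ∣ W.tamagawaProduct) : BSDp W p :=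
  bsdp_rankZero_of_twistOddRow_fourteenFacts (Kato2004.charIdeal_dvd_padicLFunctionBranch_component_of_surjective_of_half hWu)
    hDel hBFH hKo hmodP hSU hCSTrc hMaz hB hLZZ hHL hES h821 h61 W p hr hcell hp5 hsurj h2 htt hWan htam

end Summit.BirchSwinnertonDyer.BirchSwinnertonDyer.Theorems.TwistOddRowBSDp

end
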